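import Literature.Geometry.Kaehler.CechDeRham
import HarnessLib

/-!
# Transgression (the zig-zag) in the Čech–de Rham double complex

R. Bott, L. W. Tu, *Differential Forms in Algebraic Topology* (1982), §8: in the Čech–de Rham
double complex `K^{a,b} = C^a(𝔘, Ω^b)` of an open cover `𝔘 = (U_i)` of a manifold `M`
(horizontal Čech differential `δ`, vertical differential `(-1)^a d`; in the tree this is
`Literature.Geometry.Kaehler.cechDeRham I F hU` of `Kaehler/CechDeRham`, with `CechForms`,
`cechδ`, `cechd`) the `δ`-rows are exact (Prop. 8.5, the generalized Mayer–Vietoris sequence), so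
every class of the total complex is represented in the column `a = 0`, i.e. by a global form, and
`H_D{C^•(𝔘, Ω^•)} ≅ H_dR(M)` (Prop. 8.8). Concretely one descends a STAIRCASE: from a Čech
cocycle `w ∈ K^{q+1,q+1}` one solves `δ Z_{q,q+1} = w`, applies `d`, solves a `δ`-equation in
`K^{q-1,q+2}`, …, down to `Z_{0,2q+1} ∈ K^{0,2q+1}`, whose `d` is `δ`-closed, hence (rows exact in
the column `0`, Prop. 8.5) the restriction of a global `(2q+2)`-form `θ` (this is the zig-zag of
the proof of Prop. 8.8; abstractly, Weibel (1994), proof of the Acyclic Assembly Lemma 2.7.3,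
pp. 59–60: `d^v b_{-p,p+1} + d^h b_{-p+1,p} = c_{-p,p}`).

This file isolates the RELATION "`θ` is reached from `w` by such a zig-zag" for the tree's full
ordered Čech–de Rham complex, in exactly the shape in which it is inlined in the crux `SymbolLift`
of the Hodge-summit route `Theses.MilnorKExponential` (item stmt-17744; there `w_J` is a
product `∧_k g_k⁻¹ dg_k` of logarithmic derivatives of holomorphic units on `U_J` — a Čech
`(q+1)`-cochain of closed `(q+1)`-forms — and `θ` is a global closed `(2q+2)`-form whose de Rham
class is the image of the Čech class of `w` under
`Ȟ^{q+1}(𝔘, Ω^{q+1}_cl) → H^{2q+2}_D(C^•(𝔘, Ω^•)) ≅ H^{2q+2}_dR(M; ℂ)`; for the holomorphic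
Čech–de Rham complex and the Hodge filtration `F^{q+1} ∋ [θ]` see Carlson–Müller-Stach–Peters
(2017), §3.1, Thm. 3.1.5 and Prop. 3.1.6):

* `CechDeRhamTransgression hU q w θ` — the DATA of a zig-zag: cochains `Z_{a,b} ∈ C^a(𝔘, Ω^b)`
  with `δ Z_{q,q+1} = w` on every `U_J` (top), `cechd Z_{a+1,b} = δ Z_{a,b+1}` whenever
  `a + 1 + b = 2q + 1` and `a < q` (the `q` steps), and `d Z_{0,2q+1} = θ` on every `U_i` (bottom);
* `IsTransgression hU q w θ : Prop` — its propositional shadow `∃ Z, top ∧ steps ∧ bottom`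
  (`isTransgression_iff_nonempty`), literally the text requested by the route;
* API, all proved: the relation is `ℝ`-linear (`IsTransgression.zero/add/smul/neg/sub`); an exact
  global form transgresses from the zero cochain (`IsTransgression.zero_mextDeriv`: `(0, dη)`,
  Bott–Tu (8.6) `δ r = 0`), so the bottom form may be moved within its de Rham class; the bottom
  form is automatically smooth and closed on `⋃ U_i` (`IsTransgression.smoothAt`,
  `IsTransgression.mextDeriv_apply_eq_zero`; for a cover `isSmoothForm`, `isClosedForm`,
  `mem_closedSmoothForms`), and so is each top form `w_J` on `U_J`
  (`IsTransgression.smoothAt_top`, `IsTransgression.mextDeriv_top_apply_eq_zero`: `w` is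
  necessarily a cochain of CLOSED forms — for `q ≥ 1` by the first step and `δ ∘ δ = 0`, for
  `q = 0` by the bottom equation and `δ ∘ r = 0`).

Sign convention. The steps carry no extra sign: `cechd Z_{a+1,b} = cechδ Z_{a,b+1}` with
`cechd = (-1)^a d` (Weibel's sign trick, as in `Kaehler/CechDeRham`). The substitution
`Z_{a,b} ↦ (-1)^a Z_{a,b}` turns the steps into the cocycle equations
`cechδ Z_{a,b+1} + cechd Z_{a+1,b} = 0` of the total differential `D = δ + cechd`
(`ADoubleComplex.totalD`), the top into `(-1)^q w`, and leaves the bottom unchanged; so a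
transgression exhibits `D Z' = (-1)^q w + r θ` for the re-signed cochain `Z'` truncated to
`a ≤ q`, i.e. `[r θ] = (-1)^{q+1} [w]` in `H^{2q+2}_D`. The companion statement — for a `D`-closed
`w` the de Rham class of `θ` is unique and is the image of `[w]` under Prop. 8.8 — is not part of
this file.

## References

* R. Bott, L. W. Tu, *Differential Forms in Algebraic Topology*, GTM 82, Springer 1982, §8:
  (8.6), Prop. 8.5, Prop. 8.8 and its proof. [BottTu1982Forms]
* C. A. Weibel, *An Introduction to Homological Algebra*, CUP 1994, 1.2.5 (sign trick) and §2.7,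
  Acyclic Assembly Lemma 2.7.3, pp. 59–60. [Weibel1994]
* J. Carlson, S. Müller-Stach, C. Peters, *Period Mappings and Period Domains*, 2nd ed., CUP
  2017, §3.1 (Thm. 3.1.5, Prop. 3.1.6). [CarlsonMullerStachPeters2017]
-/

noncomputable section

open scoped Manifold ContDiff Topology
open Set Filter

namespace Literature.Geometry.Kaehler

variable {E : Type*} [NormedAddCommGroup E] [NormedSpace ℝ E]
  {H : Type*} [TopologicalSpace H] {I : ModelWithCorners ℝ E H}
  {M : Type*} [TopologicalSpace M] [ChartedSpace H M]
  {F : Type*} [NormedAddCommGroup F] [NormedSpace ℝ F]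
  {ι : Type*}

variable [IsManifold I ∞ M] {U : ι → Set M}

/-! ### The zig-zag as data and as a predicate -/

/-- **A transgression (zig-zag, staircase) in the Čech–de Rham double complex** of the open cover
`𝔘 = (U_i)`, from a Čech `(q+1)`-cochain `w` of `(q+1)`-forms (given as global forms `w_J`, one
for each ordered `(q+2)`-tuple `J`; only their values on `U_J` matter) down to a global
`(2q+2)`-form `θ`: cochains `Z_{a,b} ∈ C^a(𝔘, Ω^b) = CechForms I F U a b` (all bidegrees are
carried; only the anti-diagonal `a + b = 2q + 1`, `a ≤ q`, is constrained) such that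
`δ Z_{q,q+1} = w_J` on every `U_J` (top), `cechd Z_{a+1,b} = δ Z_{a,b+1}` in `C^{a+1}(𝔘, Ω^{b+1})`
whenever `a + 1 + b = 2q + 1` and `a < q` (the `q` steps; `cechd = (-1)^a d`), and
`d Z_{0,2q+1} = θ` on every `U_i` (bottom). This is the staircase of the proof of Bott–Tu (1982),
Prop. 8.8 (`H_D{C^•(𝔘, Ω^•)} ≅ H_dR(M)`: a `D`-cocycle is moved into the column `0` using the
exactness of the rows, Prop. 8.5), written out for the tree's full ordered Čech–de Rham complex
`cechDeRham I F hU`; see the module docstring for the sign convention.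
[cite: BottTu1982Forms, §8 Prop. 8.8] -/
structure CechDeRhamTransgression (hU : ∀ i, IsOpen (U i)) (q : ℕ)
    (w : (Fin (q + 2) → ι) → MForm I M F (q + 1)) (θ : MForm I M F (2 * q + 1 + 1)) where
  /-- The cochains `Z_{a,b} ∈ C^a(𝔘, Ω^b)`. [cite: BottTu1982Forms, §8 Prop. 8.8] -/
  cochain : (a b : ℕ) → CechForms I F U a b
  /-- Top of the staircase: `δ Z_{q,q+1} = w_J` on each `U_J`, `J` an ordered `(q+2)`-tuple.
  [cite: BottTu1982Forms, §8 Prop. 8.8] -/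
  cechδ_top : ∀ (J : Fin (q + 2) → ι), ∀ x ∈ cechSet U J,
    (cechδ I F hU q (q + 1) (cochain q (q + 1)) J : MForm I M F (q + 1)) x = w J x
  /-- The steps: `cechd Z_{a+1,b} = δ Z_{a,b+1}` in `C^{a+1}(𝔘, Ω^{b+1})` for `a + 1 + b = 2q + 1`,
  `a < q`. [cite: BottTu1982Forms, §8 Prop. 8.8] -/
  cechd_eq_cechδ : ∀ a b : ℕ, a + 1 + b = 2 * q + 1 → a < q →
    cechd I F hU (a + 1) b (cochain (a + 1) b) = cechδ I F hU a (b + 1) (cochain a (b + 1))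
  /-- Bottom of the staircase: `d Z_{0,2q+1} = θ` on each `U_i`.
  [cite: BottTu1982Forms, §8 Prop. 8.8] -/
  cechd_bottom : ∀ (J : Fin 1 → ι), ∀ x ∈ cechSet U J,
    (cechd I F hU 0 (2 * q + 1) (cochain 0 (2 * q + 1)) J : MForm I M F (2 * q + 1 + 1)) x = θ x

/-- **The transgression predicate** `IsTransgression hU q w θ`: there EXISTS a zig-zag
`Z = (Z_{a,b})` in the Čech–de Rham complex of `𝔘` with top `w` (`δ Z_{q,q+1} = w` on each `U_J`),
steps `cechd Z_{a+1,b} = δ Z_{a,b+1}` (`a + 1 + b = 2q + 1`, `a < q`) and bottom `θ`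
(`d Z_{0,2q+1} = θ` on each `U_i`) — the propositional form of `CechDeRhamTransgression`
(`isTransgression_iff_nonempty`), spelled exactly as inlined in the route
`Theses.MilnorKExponential` of the Hodge summit (crux `SymbolLift`, item stmt-17744). When `𝔘`
covers `M` it exhibits `θ` as a closed smooth form (`IsTransgression.mem_closedSmoothForms`) whose
de Rham class is, up to the sign `(-1)^{q+1}`, the image of the Čech class of the (necessarily
`D`-closed) cochain `w` under
`Ȟ^{q+1}(𝔘, Ω^{q+1}_cl) → H^{2q+2}_D(C^•(𝔘, Ω^•)) ≅ H^{2q+2}_dR(M)` (Bott–Tu (1982), Prop. 8.8, the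
staircase of its proof). [cite: BottTu1982Forms, §8 Prop. 8.8] -/
def IsTransgression (hU : ∀ i, IsOpen (U i)) (q : ℕ)
    (w : (Fin (q + 2) → ι) → MForm I M F (q + 1)) (θ : MForm I M F (2 * q + 1 + 1)) : Prop :=
  ∃ Z : (a b : ℕ) → CechForms I F U a b,
    (∀ (J : Fin (q + 2) → ι), ∀ x ∈ cechSet U J,
        (cechδ I F hU q (q + 1) (Z q (q + 1)) J : MForm I M F (q + 1)) x = w J x) ∧
    (∀ a b : ℕ, a + 1 + b = 2 * q + 1 → a < q →
        cechd I F hU (a + 1) b (Z (a + 1) b) = cechδ I F hU a (b + 1) (Z a (b + 1))) ∧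
    (∀ (J : Fin 1 → ι), ∀ x ∈ cechSet U J,
        (cechd I F hU 0 (2 * q + 1) (Z 0 (2 * q + 1)) J : MForm I M F (2 * q + 1 + 1)) x = θ x)

variable {hU : ∀ i, IsOpen (U i)} {q : ℕ}
  {w w₁ w₂ : (Fin (q + 2) → ι) → MForm I M F (q + 1)} {θ θ₁ θ₂ : MForm I M F (2 * q + 1 + 1)}

/-- A transgression datum witnesses the transgression predicate. [folklore] -/
theorem CechDeRhamTransgression.isTransgression (t : CechDeRhamTransgression hU q w θ) :
    IsTransgression hU q w θ :=
  ⟨t.cochain, t.cechδ_top, t.cechd_eq_cechδ, t.cechd_bottom⟩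

/-- `IsTransgression` is the propositional shadow of `CechDeRhamTransgression`. [folklore] -/
theorem isTransgression_iff_nonempty :
    IsTransgression hU q w θ ↔ Nonempty (CechDeRhamTransgression hU q w θ) :=
  ⟨fun ⟨Z, h₁, h₂, h₃⟩ ↦ ⟨⟨Z, h₁, h₂, h₃⟩⟩, fun ⟨t⟩ ↦ t.isTransgression⟩

namespace IsTransgression

/-- A choice of zig-zag behind a transgression. [folklore] -/
def data (h : IsTransgression hU q w θ) : CechDeRhamTransgression hU q w θ :=
  Classical.choice (isTransgression_iff_nonempty.1 h)

/-! ### Linearity of the relation -/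

/-- The zero cochain transgresses `w = 0` to `θ = 0`. [folklore] -/
protected theorem zero :
    IsTransgression hU q (0 : (Fin (q + 2) → ι) → MForm I M F (q + 1)) 0 := by
  refine ⟨0, fun J x _ ↦ ?_, fun a b _ _ ↦ ?_, fun J x _ ↦ ?_⟩ <;>
    simp only [Pi.zero_apply, map_zero, ZeroMemClass.coe_zero]

/-- Transgressions add (add the zig-zags). [folklore] -/
theorem add (h₁ : IsTransgression hU q w₁ θ₁) (h₂ : IsTransgression hU q w₂ θ₂) :
    IsTransgression hU q (w₁ + w₂) (θ₁ + θ₂) := by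
  obtain ⟨Z₁, t₁, s₁, b₁⟩ := h₁
  obtain ⟨Z₂, t₂, s₂, b₂⟩ := h₂
  refine ⟨Z₁ + Z₂, fun J x hx ↦ ?_, fun a b hab ha ↦ ?_, fun J x hx ↦ ?_⟩
  · simp only [Pi.add_apply, map_add, Submodule.coe_add, t₁ J x hx, t₂ J x hx]
  · simp only [Pi.add_apply, map_add, s₁ a b hab ha, s₂ a b hab ha]
  · simp only [Pi.add_apply, map_add, Submodule.coe_add, b₁ J x hx, b₂ J x hx]

/-- Transgressions are homogeneous for real scalars (scale the zig-zag). [folklore] -/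
theorem smul (c : ℝ) (h : IsTransgression hU q w θ) : IsTransgression hU q (c • w) (c • θ) := by
  obtain ⟨Z, t, s, b⟩ := h
  refine ⟨c • Z, fun J x hx ↦ ?_, fun a b' hab ha ↦ ?_, fun J x hx ↦ ?_⟩
  · simp only [Pi.smul_apply, map_smul, Submodule.coe_smul, t J x hx]
  · simp only [Pi.smul_apply, map_smul, s a b' hab ha]
  · simp only [Pi.smul_apply, map_smul, Submodule.coe_smul, b J x hx]

/-- Transgressions may be negated. [folklore] -/
theorem neg (h : IsTransgression hU q w θ) : IsTransgression hU q (-w) (-θ) := by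
  simpa only [neg_one_smul] using h.smul (-1)

/-- Transgressions subtract. [folklore] -/
theorem sub (h₁ : IsTransgression hU q w₁ θ₁) (h₂ : IsTransgression hU q w₂ θ₂) :
    IsTransgression hU q (w₁ - w₂) (θ₁ - θ₂) := by
  simpa only [sub_eq_add_neg] using h₁.add h₂.neg

/-! ### Exact global forms transgress from the zero cochain -/

/-- **Exact global forms transgress from zero**: for a smooth global `(2q+1)`-form `η` the pair
`(w, θ) = (0, dη)` is a transgression — take `Z_{0,2q+1} = r η` (the restrictions `η|_{U_i}`) and
all other `Z_{a,b} = 0`; then `δ Z_{0,•} = δ r (•) = 0` (Bott–Tu (1982), (8.6)) and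
`d (r η) = r (dη)`. With `IsTransgression.add`: the bottom form of a transgression may be changed
by any exact smooth form without changing the top. [cite: BottTu1982Forms, §8 Prop. 8.5] -/
theorem zero_mextDeriv {η : MForm I M F (2 * q + 1)} (hη : IsSmoothForm η) :
    IsTransgression hU q (0 : (Fin (q + 2) → ι) → MForm I M F (q + 1)) (mextDeriv η) := by
  -- `η` as a form on `univ`, placed in bidegrees `(0, 2q+1)` of a family of global forms
  let ηu : smoothFormsOn I F (univ : Set M) (2 * q + 1) := ⟨η, by rwa [smoothFormsOn_univ]⟩
  let T : (b : ℕ) → ↥(smoothFormsOn I F (univ : Set M) b) := Pi.single (2 * q + 1) ηu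
  let S : (a b : ℕ) → ↥(smoothFormsOn I F (univ : Set M) b) := fun a b ↦ if a = 0 then T b else 0
  -- the zig-zag: restrict `S a b` to every `U_J`
  let Z : (a b : ℕ) → CechForms I F U a b := fun a b J ↦
    restrictₗ I F b (isOpen_cechSet hU J) (subset_univ _) (S a b)
  have hS : ∀ a b, S (a + 1) b = 0 := fun a b ↦ if_neg (Nat.succ_ne_zero a)
  have hS0 : S 0 (2 * q + 1) = ηu := by
    change (if (0 : ℕ) = 0 then T (2 * q + 1) else 0) = ηu
    rw [if_pos rfl]
    exact Pi.single_eq_same _ _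
  have hZ : ∀ a b, Z (a + 1) b = 0 := fun a b ↦ funext fun J ↦ by
    change restrictₗ I F b (isOpen_cechSet hU J) (subset_univ _) (S (a + 1) b) = 0
    rw [hS, map_zero]
  -- in the column `0`, `Z 0 b = r (S 0 b)` and `δ ∘ r = 0`
  have hδ0 : ∀ b, cechδ I F hU 0 b (Z 0 b) = 0 := fun b ↦ (cechDeRhamRow I F hU).δ_ε b (S 0 b)
  refine ⟨Z, fun J x _ ↦ ?_, fun a b _ _ ↦ ?_, fun J x hx ↦ ?_⟩
  · -- top: `δ Z_{q,q+1} = 0`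
    cases q with
    | zero => rw [hδ0]; rfl
    | succ k => rw [hZ, map_zero]; rfl
  · -- steps: both sides vanish
    rw [hZ, map_zero]
    cases a with
    | zero => exact (hδ0 _).symm
    | succ a => rw [hZ, map_zero]
  · -- bottom: `d (η|_{U_i}) = dη` on `U_i`
    rw [cechd_apply, pow_zero, one_smul, localD_apply_of_mem _ _ hx]
    have hZ0 : (Z 0 (2 * q + 1) J : MForm I M F (2 * q + 1)) = η.restr (cechSet U J) := by
      change ((S 0 (2 * q + 1) : smoothFormsOn I F (univ : Set M) (2 * q + 1)) :
        MForm I M F (2 * q + 1)).restr (cechSet U J) = _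
      rw [hS0]
    rw [hZ0, mextDeriv_restr_apply (isOpen_cechSet hU J) η hx]

/-! ### The bottom form is smooth and closed on `⋃ U_i` -/

/-- Near a point of `U_i` the bottom form of a transgression is `d` of the component
`(Z_{0,2q+1})_{(i)}`, a form smooth on `U_i`. [folklore] -/
theorem exists_eventuallyEq_mextDeriv (h : IsTransgression hU q w θ) {i : ι} {x : M}
    (hx : x ∈ U i) :
    ∃ β : MForm I M F (2 * q + 1), (∀ᶠ y in 𝓝 x, β.SmoothAt y) ∧
      ∀ᶠ y in 𝓝 x, θ y = mextDeriv β y := by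
  obtain ⟨Z, -, -, hb⟩ := h
  let J : Fin 1 → ι := fun _ ↦ i
  have hJ : cechSet U J = U i := cechSet_fin_one U J
  refine ⟨(Z 0 (2 * q + 1) J : MForm I M F (2 * q + 1)), ?_, ?_⟩
  · exact eventually_smoothAt_of_mem (isOpen_cechSet hU J) (Z 0 (2 * q + 1) J).2 (hJ.symm ▸ hx)
  · filter_upwards [(hU i).mem_nhds hx] with y hy
    have hyJ : y ∈ cechSet U J := hJ.symm ▸ hy
    rw [← hb J y hyJ, cechd_apply, pow_zero, one_smul, localD_apply_of_mem _ _ hyJ]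

/-- The bottom form of a transgression is smooth at every point of `⋃ U_i`. [folklore] -/
theorem smoothAt (h : IsTransgression hU q w θ) {i : ι} {x : M} (hx : x ∈ U i) :
    θ.SmoothAt x := by
  obtain ⟨β, hβ, hθ⟩ := h.exists_eventuallyEq_mextDeriv hx
  exact (MForm.smoothAt_congr_of_eventuallyEq hθ).2 (MForm.SmoothAt.mextDeriv hβ)

/-- **The bottom form of a transgression is closed on `⋃ U_i`**: there `dθ = d(dZ) = 0`.
[folklore] -/
theorem mextDeriv_apply_eq_zero (h : IsTransgression hU q w θ) {i : ι} {x : M} (hx : x ∈ U i) :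
    mextDeriv θ x = 0 := by
  obtain ⟨β, hβ, hθ⟩ := h.exists_eventuallyEq_mextDeriv hx
  rw [mextDeriv_congr_of_eventuallyEq hθ]
  exact mextDeriv_mextDeriv_of_smoothAt hβ

/-- If `𝔘` covers `M`, the bottom form of a transgression is a smooth form. [folklore] -/
theorem isSmoothForm (h : IsTransgression hU q w θ) (hcov : ∀ x, ∃ i, x ∈ U i) :
    IsSmoothForm θ :=
  (isSmoothForm_iff_smoothAt θ).2 fun x ↦ (hcov x).elim fun _ hx ↦ h.smoothAt hx

/-- If `𝔘` covers `M`, the bottom form of a transgression is closed. [folklore] -/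
theorem isClosedForm (h : IsTransgression hU q w θ) (hcov : ∀ x, ∃ i, x ∈ U i) :
    IsClosedForm θ := by
  refine funext fun x ↦ ?_
  obtain ⟨i, hx⟩ := hcov x
  simpa only [Pi.zero_apply] using h.mextDeriv_apply_eq_zero hx

/-- If `𝔘` covers `M`, the bottom form of a transgression is a closed smooth form, so it has a de
Rham class. [folklore] -/
theorem mem_closedSmoothForms (h : IsTransgression hU q w θ) (hcov : ∀ x, ∃ i, x ∈ U i) :
    θ ∈ closedSmoothForms I M F (2 * q + 1 + 1) :=
  (mem_closedSmoothForms_iff θ).2 ⟨h.isSmoothForm hcov, h.isClosedForm hcov⟩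

/-! ### The top forms are smooth and closed on the `U_J` -/

/-- Near a point of `U_J` the top form `w_J` of a transgression is the `J`-component of
`δ Z_{q,q+1}`, a form smooth on `U_J`. [folklore] -/
theorem smoothAt_top (h : IsTransgression hU q w θ) (J : Fin (q + 2) → ι) {x : M}
    (hx : x ∈ cechSet U J) : (w J).SmoothAt x := by
  obtain ⟨Z, ht, -, -⟩ := h
  have hev : ∀ᶠ y in 𝓝 x, (cechδ I F hU q (q + 1) (Z q (q + 1)) J : MForm I M F (q + 1)) y =
      w J y := by
    filter_upwards [(isOpen_cechSet hU J).mem_nhds hx] with y hy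
    exact ht J y hy
  exact (MForm.smoothAt_congr_of_eventuallyEq hev).1
    ((cechδ I F hU q (q + 1) (Z q (q + 1)) J).2.1 x hx)

/-- **The top forms of a transgression are closed on the `U_J`**: `d w_J = 0` on `U_J`. Indeed
`d w = d δ Z_{q,q+1} = ∓ δ d Z_{q,q+1}`, and `d Z_{q,q+1}` is `δ Z_{q-1,q+2}` by the first step if
`q ≥ 1` (so `δ δ = 0`), while for `q = 0` it is the cochain of restrictions of `θ` by the bottom
equation (so `δ r = 0`). Thus only cochains of CLOSED forms can be transgressed. [folklore] -/
theorem mextDeriv_top_apply_eq_zero (h : IsTransgression hU q w θ) (J : Fin (q + 2) → ι) {x : M}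
    (hx : x ∈ cechSet U J) : mextDeriv (w J) x = 0 := by
  obtain ⟨Z, ht, hs, hb⟩ := h
  -- `w_J` agrees with the `J`-component `γ` of `δ Z_{q,q+1}` near `x`
  have hev : ∀ᶠ y in 𝓝 x, w J y =
      (cechδ I F hU q (q + 1) (Z q (q + 1)) J : MForm I M F (q + 1)) y := by
    filter_upwards [(isOpen_cechSet hU J).mem_nhds hx] with y hy
    exact (ht J y hy).symm
  rw [mextDeriv_congr_of_eventuallyEq hev,
    ← localD_apply_of_mem (isOpen_cechSet hU J) (cechδ I F hU q (q + 1) (Z q (q + 1)) J) hx]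
  -- `(-1)^{q+1} d (δ Z)_J = -(δ (cechd Z))_J` (anticommutation of the double complex at `J`)
  have hanti := (cechDeRham I F hU).anticomm q (q + 1) (Z q (q + 1))
  change cechδ I F hU q (q + 1 + 1) (cechd I F hU q (q + 1) (Z q (q + 1))) +
    cechd I F hU (q + 1) (q + 1) (cechδ I F hU q (q + 1) (Z q (q + 1))) = 0 at hanti
  have hJ := congrFun hanti J
  rw [Pi.add_apply, cechd_apply, Pi.zero_apply] at hJ
  have hcL : (-1 : ℝ) ^ (q + 1) •
      localD I F (q + 1) (isOpen_cechSet hU J) (cechδ I F hU q (q + 1) (Z q (q + 1)) J) =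
        -cechδ I F hU q (q + 1 + 1) (cechd I F hU q (q + 1) (Z q (q + 1))) J :=
    eq_neg_of_add_eq_zero_right hJ
  have hL : localD I F (q + 1) (isOpen_cechSet hU J) (cechδ I F hU q (q + 1) (Z q (q + 1)) J) =
      (-1 : ℝ) ^ (q + 1) • ((-1 : ℝ) ^ (q + 1) •
        localD I F (q + 1) (isOpen_cechSet hU J) (cechδ I F hU q (q + 1) (Z q (q + 1)) J)) := by
    rw [smul_smul, ← pow_add, ← two_mul, pow_mul, neg_one_sq, one_pow, one_smul]
  -- it remains to see that `δ (cechd Z_{q,q+1})` vanishes at `x ∈ U_J`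
  suffices hδd : (cechδ I F hU q (q + 1 + 1) (cechd I F hU q (q + 1) (Z q (q + 1))) J :
      MForm I M F (q + 1 + 1)) x = 0 by
    rw [hL, hcL, Submodule.coe_smul, Pi.smul_apply, Submodule.coe_neg, Pi.neg_apply, hδd, neg_zero,
      smul_zero]
  cases q with
  | zero =>
    -- `q = 0`: `cechd Z_{0,1}` is the cochain `(θ|_{U_i})` on the `U_i`, and `δ` of it vanishes
    have hb' : ∀ (J' : Fin 1 → ι), ∀ y ∈ cechSet U J',
        (cechd I F hU 0 (0 + 1) (Z 0 (0 + 1)) J' : MForm I M F (0 + 1 + 1)) y = θ y := hb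
    rw [coe_cechδ_apply_apply_of_mem hU _ hx]
    have hj := fun j : Fin (0 + 2) ↦ hb' _ x (cechSet_subset_comp U J (Fin.succAbove j) hx)
    simp only [hj]
    rw [Fin.sum_univ_two, Fin.val_zero, pow_zero, one_smul, Fin.val_one, pow_one, neg_one_smul,
      add_neg_cancel]
  | succ k =>
    -- `q = k + 1`: the first step `cechd Z_{k+1,k+2} = δ Z_{k,k+3}` and `δ ∘ δ = 0`
    have hstep := hs k (k + 1 + 1) (by omega) (Nat.lt_succ_self k)
    have hδδ := (cechDeRham I F hU).δ_δ k (k + 1 + 1 + 1) (Z k (k + 1 + 1 + 1))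
    change cechδ I F hU (k + 1) (k + 1 + 1 + 1)
      (cechδ I F hU k (k + 1 + 1 + 1) (Z k (k + 1 + 1 + 1))) = 0 at hδδ
    rw [hstep, hδδ]
    rfl

end IsTransgression

end Literature.Geometry.Kaehler
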